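import Summits.AtomisticToContinuum.Crystallization.Theorems.FreeSplittingCertificatesStrictSplittingRuleP1FarSiteShares

/-!
# `StrictSplittingRule` (stmt-AtomisticToContinuum-12560): THE (S) TAIL LEMMA — per-site domination holds IN THE KERNEL at every site `q` with `‖y_q − y_p‖ ≥ 20a`; hypothesis (S) of the endpoint becomes a FINITE statement (P1 interpolant object, part 83)

Route `FreeSplittingCertificates`, crux r3 `StrictSplittingRule` (H12⋆ = `stub_coreJointCoercive`), unit b2b-freesplit-B gen 36.
VALUE = a kernel theorem replacing an external certificate (HOME FAR-LEMMA-SPEC §20 (c)/(e)(3), "per-site domination TAIL lemma from the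
landed `V`, `m₁`, `Σ₂`", owed since gen 27): hypothesis (S) of `coreJointCoercive_cell_of_certificates₈` (part 79) asks, for EVERY site `q`
off the reach set, `0 ≤ ½(W′(s_q)|z|² + 2W″(s_q)⟨d_q,z⟩²) + Bare_rad,q(z) − Bare_cred,q(z)` for all `z` — an infinite family, certified outside
the kernel by the interval range runs 5.8–26a (farval.py) AND the tail engine tailcert.py (≥ 17.9a).  Here it is PROVED for all `q` with
`‖y_q − y_p‖ ≥ 20a`, uniformly on the `HcpFamilyMin` box, by the algebraic second-order expansion of parts 81/82; the assembled form
`A|z|² + B⟨d,z⟩²/r² − Γ|⟨d,z⟩||z|/r` has `A ≥ 3/100`, `B ≥ 1/5`, `Γ ≤ 1/10` at `r ≥ 20a` (`tail_numeric`; asymptotic margins: tangential `1/16`,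
radial `7/16` of `r⁻⁸|z|²`).
* `tail_numeric` (the numerical heart on the box), `sqrt_three_bounds`, `tail_identity` (assembly identity);
* **`farSite_domination`** — the (S) inequality at every far site, literally the body of hypothesis (S);
* `twenty_le_of_not_mem_tailBox` — outside the index box `Icc(p.1 ± 26) × Icc(p.2.1 ± 34) × Icc(p.2.2 ± 23)` every site is `≥ 20a` away;
* **`coreJointCoercive_cell_of_certificates₉`** — part 79's endpoint with (S) asked only for the sites of that FINITE box with `‖y_q − y_p‖ < 20a`.
Outside the kernel (S) is now a finite interval-arithmetic table (covered by the certified range runs 5.8–26a, HOME CERT §29–§31); the tail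
engine leaves the trust base.  NOT a proof of H12⋆ ((B∃), finite (S), (TAB), (PAY), (NC∃) remain certificate-tier hypotheses), NOT summit
progress.  [folklore]
-/

noncomputable section

open Set Function Metric MeasureTheory Filter Topology
open scoped BigOperators NNReal ENNReal Classical

namespace Summit.AtomisticToContinuum.Crystallization.Theorems.StrictSplittingRuleBirth

open Literature.MathematicalPhysics.StatisticalMechanics
open Summit.AtomisticToContinuum.Crystallization.Theorems.PalmUnimodularRigidity.LayeredLawsSelectHcp

/-! ## Numerics on the `HcpFamilyMin` box at `r ≥ 20a` -/

/-- **The numerical heart**: with `V ∈ [0.647, 0.64808]` (`= √3a²h/2`), `W = a²h ≤ 0.74832`, `v = a/r ≤ 1/20`, `η² = h²/a² ≤ 0.66679`,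
`√3 ≤ 1.73206`, `r⁻⁶ ≤ 1/64`, the assembled form `A·ζ² + B·u² − Γ·uζ` is nonnegative (`A ≥ 3/100`, `B ≥ 1/5`, `Γ ≤ 1/10`). -/
theorem tail_numeric {V W v η2 s3 r6 u ζ : ℝ} (hV1 : 0.647 ≤ V) (hV2 : V ≤ 0.64808) (hW0 : 0 ≤ W) (hW : W ≤ 0.74832)
    (hv0 : 0 ≤ v) (hv : v ≤ 1 / 20) (hη0 : 0 ≤ η2) (hη : η2 ≤ 0.66679) (hs0 : 0 ≤ s3) (hs : s3 ≤ 1.73206)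
    (hr0 : 0 ≤ r6) (hr6 : r6 ≤ 1 / 64) (hu : 0 ≤ u) (hζ : 0 ≤ ζ) :
    0 ≤ (1 / 4 * (1 - r6) - (193 / 125) * ((3 / 4 : ℝ) / 4) *
          (V + 2 / 3 * W * v + 10 * V * v ^ 2 + 18 * V * (2 / 9 + η2 / 6) * (6 * v ^ 3 + 9 / 4 * v ^ 4)) -
          (193 / 125) * ((7 * (5 / 4 : ℝ) + 3 / 4) / 4) * (135 / 4) * V * v ^ 3) * ζ ^ 2 +
      (7 / 2 * r6 - 2 + (193 / 125) * ((7 * (5 / 4 : ℝ) + 3 / 4) / 4) * (V - 5 / 6 * W * v - 5 * V * (2 / 9 + η2 / 6) * v ^ 2)) * u ^ 2 -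
      (193 / 125) * ((7 * (5 / 4 : ℝ) + 3 / 4) / 4) * (W * v / 6 + 20 * V * (1 / 8 + s3 / 36 + 7 / 72 + η2 / 6) * v ^ 2) * (u * ζ) := by
  -- the three coefficient bounds
  have hS1 : V + 2 / 3 * W * v + 10 * V * v ^ 2 + 18 * V * (2 / 9 + η2 / 6) * (6 * v ^ 3 + 9 / 4 * v ^ 4) ≤
      0.64808 + 2 / 3 * 0.74832 * (1 / 20) + 10 * 0.64808 * (1 / 20) ^ 2 +
        18 * 0.64808 * (2 / 9 + 0.66679 / 6) * (6 * (1 / 20) ^ 3 + 9 / 4 * (1 / 20) ^ 4) := by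
    gcongr
  have hS2 : V * v ^ 3 ≤ 0.64808 * (1 / 20) ^ 3 := by gcongr
  have hA : (3 : ℝ) / 100 ≤ 1 / 4 * (1 - r6) - (193 / 125) * ((3 / 4 : ℝ) / 4) *
          (V + 2 / 3 * W * v + 10 * V * v ^ 2 + 18 * V * (2 / 9 + η2 / 6) * (6 * v ^ 3 + 9 / 4 * v ^ 4)) -
          (193 / 125) * ((7 * (5 / 4 : ℝ) + 3 / 4) / 4) * (135 / 4) * V * v ^ 3 := by
    nlinarith
  have hS3 : 5 / 6 * W * v ≤ 5 / 6 * 0.74832 * (1 / 20) := by gcongr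
  have hS4 : 5 * V * (2 / 9 + η2 / 6) * v ^ 2 ≤ 5 * 0.64808 * (2 / 9 + 0.66679 / 6) * (1 / 20) ^ 2 := by gcongr
  have hB : (1 : ℝ) / 5 ≤ 7 / 2 * r6 - 2 + (193 / 125) * ((7 * (5 / 4 : ℝ) + 3 / 4) / 4) *
      (V - 5 / 6 * W * v - 5 * V * (2 / 9 + η2 / 6) * v ^ 2) := by
    nlinarith
  have hS5 : W * v / 6 + 20 * V * (1 / 8 + s3 / 36 + 7 / 72 + η2 / 6) * v ^ 2 ≤
      0.74832 * (1 / 20) / 6 + 20 * 0.64808 * (1 / 8 + 1.73206 / 36 + 7 / 72 + 0.66679 / 6) * (1 / 20) ^ 2 := by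
    gcongr
  have hG : (193 / 125) * ((7 * (5 / 4 : ℝ) + 3 / 4) / 4) * (W * v / 6 + 20 * V * (1 / 8 + s3 / 36 + 7 / 72 + η2 / 6) * v ^ 2) ≤
      1 / 10 := by
    nlinarith
  have hG0 : 0 ≤ (193 / 125) * ((7 * (5 / 4 : ℝ) + 3 / 4) / 4) * (W * v / 6 + 20 * V * (1 / 8 + s3 / 36 + 7 / 72 + η2 / 6) * v ^ 2) := by
    positivity
  -- the quadratic form
  set A := 1 / 4 * (1 - r6) - (193 / 125) * ((3 / 4 : ℝ) / 4) *
          (V + 2 / 3 * W * v + 10 * V * v ^ 2 + 18 * V * (2 / 9 + η2 / 6) * (6 * v ^ 3 + 9 / 4 * v ^ 4)) -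
          (193 / 125) * ((7 * (5 / 4 : ℝ) + 3 / 4) / 4) * (135 / 4) * V * v ^ 3
  set B := 7 / 2 * r6 - 2 + (193 / 125) * ((7 * (5 / 4 : ℝ) + 3 / 4) / 4) * (V - 5 / 6 * W * v - 5 * V * (2 / 9 + η2 / 6) * v ^ 2)
  set G := (193 / 125) * ((7 * (5 / 4 : ℝ) + 3 / 4) / 4) * (W * v / 6 + 20 * V * (1 / 8 + s3 / 36 + 7 / 72 + η2 / 6) * v ^ 2)
  have h1 : 3 / 100 * ζ ^ 2 ≤ A * ζ ^ 2 := mul_le_mul_of_nonneg_right hA (sq_nonneg ζ)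
  have h2 : 1 / 5 * u ^ 2 ≤ B * u ^ 2 := mul_le_mul_of_nonneg_right hB (sq_nonneg u)
  have h3 : G * (u * ζ) ≤ 1 / 10 * (u * ζ) := mul_le_mul_of_nonneg_right hG (mul_nonneg hu hζ)
  nlinarith [sq_nonneg (u - ζ / 4), sq_nonneg ζ]

/-! ## THE (S) TAIL LEMMA -/

/-- `√3` to five places. -/
theorem sqrt_three_bounds : (1.73205 : ℝ) ≤ √3 ∧ √3 ≤ 1.73206 := by
  constructor
  · rw [show (1.73205 : ℝ) = √(1.73205 ^ 2) by rw [Real.sqrt_sq (by norm_num)]]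
    exact Real.sqrt_le_sqrt (by norm_num)
  · rw [show (1.73206 : ℝ) = √(1.73206 ^ 2) by rw [Real.sqrt_sq (by norm_num)]]
    exact Real.sqrt_le_sqrt (by norm_num)

/-- The assembly identity behind `farSite_domination` (pure algebra; `s` stands for `√3`). -/
theorem tail_identity (s a h r u ζ : ℝ) (ha : a ≠ 0) (hr : r ≠ 0) :
    ((r ^ 2)⁻¹) ^ 4 *
      ((1 / 4 * (1 - ((r ^ 2)⁻¹) ^ 3) - (193 / 125) * ((3 / 4 : ℝ) / 4) *
          (s * a ^ 2 * h / 2 + 2 / 3 * (a ^ 2 * h) * (a / r) + 10 * (s * a ^ 2 * h / 2) * (a / r) ^ 2 +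
            18 * (s * a ^ 2 * h / 2) * (2 / 9 + h ^ 2 / a ^ 2 / 6) * (6 * (a / r) ^ 3 + 9 / 4 * (a / r) ^ 4)) -
          (193 / 125) * ((7 * (5 / 4 : ℝ) + 3 / 4) / 4) * (135 / 4) * (s * a ^ 2 * h / 2) * (a / r) ^ 3) * ζ ^ 2 +
      (7 / 2 * ((r ^ 2)⁻¹) ^ 3 - 2 + (193 / 125) * ((7 * (5 / 4 : ℝ) + 3 / 4) / 4) *
        (s * a ^ 2 * h / 2 - 5 / 6 * (a ^ 2 * h) * (a / r) - 5 * (s * a ^ 2 * h / 2) * (2 / 9 + h ^ 2 / a ^ 2 / 6) * (a / r) ^ 2)) * u ^ 2 -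
      (193 / 125) * ((7 * (5 / 4 : ℝ) + 3 / 4) / 4) *
        (a ^ 2 * h * (a / r) / 6 + 20 * (s * a ^ 2 * h / 2) * (1 / 8 + s / 36 + 7 / 72 + h ^ 2 / a ^ 2 / 6) * (a / r) ^ 2) * (u * ζ)) =
    1 / 2 * (1 / 2 * (((r ^ 2)⁻¹) ^ 4 - ((r ^ 2)⁻¹) ^ 7) * ζ ^ 2 + 2 * (1 / 2 * (7 * ((r ^ 2)⁻¹) ^ 8 - 4 * ((r ^ 2)⁻¹) ^ 5)) * (u ^ 2 * r ^ 2)) +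
      (193 / 125) * ((7 * (5 / 4 : ℝ) + 3 / 4) / 4) * ((r ^ 2)⁻¹) ^ 5 *
        (u ^ 2 * r ^ 2 * (s * a ^ 2 * h / 2) - 135 / 4 * (a ^ 3 / r) * ζ ^ 2 * (s * a ^ 2 * h / 2) -
          a ^ 3 * h / 6 * (u * r) * ζ - 5 / 6 * (a ^ 3 * h / r) * (u ^ 2 * r ^ 2) -
          20 * (s * a ^ 2 * h / 2) * ((1 / 8 + s / 36 + 7 / 72) * a ^ 2 + h ^ 2 / 6) * (u * r) * ζ / r -
          5 * (s * a ^ 2 * h / 2) * (2 / 9 * a ^ 2 + h ^ 2 / 6) * (u ^ 2 * r ^ 2) / r ^ 2) -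
      (193 / 125) * ((3 / 4 : ℝ) / 4) * ζ ^ 2 * ((r ^ 2)⁻¹) ^ 4 *
        (s * a ^ 2 * h / 2 + 2 / 3 * a ^ 3 * h / r + 10 * a ^ 2 / r ^ 2 * (s * a ^ 2 * h / 2) +
          18 / (r ^ 2) ^ 2 * (6 * a * r + 9 / 4 * a ^ 2) * ((s * a ^ 2 * h / 2) * (2 / 9 * a ^ 2 + h ^ 2 / 6))) := by
  field_simp
  ring

/-- **THE (S) TAIL LEMMA (per-site domination at every far site, in the kernel).**  For the hcp family minimiser `(a,h)` and ANY two sites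
`p, q` with `‖y_q − y_p‖ ≥ 20a`, for every `z ∈ ℝ³`:
`0 ≤ ½(W′(s)|z|² + 2W″(s)⟨y_q − y_p, z⟩²) + Bare_rad,q(z) − Bare_cred,q(z)` (`s = ‖y_q − y_p‖²`) — literally the body of hypothesis (S) of
`coreJointCoercive_cell_of_certificates₈`.  Asymptotic margins `1/16` (tangential) and `7/16` (radial) of `r⁻⁸|z|²`; at `20a` the proved form is
`A|z|² + B⟨d,z⟩²/r² − Γ|⟨d,z⟩||z|/r` with `A ≥ 3/100`, `B ≥ 1/5`, `Γ ≤ 1/10`.  NOT a proof of H12⋆, NOT summit progress. -/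
theorem farSite_domination {a h : ℝ} (ha : 0 < a) (hh : 0 < h) (hfam : HcpFamilyMin a h) (p q : ℤ × ℤ × ℤ)
    (hfar : 20 * a ≤ ‖hcpSite a h q - hcpSite a h p‖) (z : Fin 3 → ℝ) :
    0 ≤ 1 / 2 * (ljSqDeriv (‖hcpSite a h q - hcpSite a h p‖ ^ 2) * fpSq z +
          2 * (1 / 2 * (7 * ((‖hcpSite a h q - hcpSite a h p‖ ^ 2)⁻¹) ^ 8 -
            4 * ((‖hcpSite a h q - hcpSite a h p‖ ^ 2)⁻¹) ^ 5)) * p1NRad a h p (fun _ => z) q ^ 2) +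
        p1SiteBare a h (fun y k l => (193 / 125) * ((7 * (5 / 4 : ℝ) + 3 / 4) / 4) * fpChi ((81 / 20 * a) ^ 2) ((27 / 5 * a) ^ 2) (y - fun k => hcpSite a h p k) ^ 2 *
          (fpSq (y - fun k => hcpSite a h p k))⁻¹ ^ 5 * ((y - fun k => hcpSite a h p k) k * (y - fun k => hcpSite a h p k) l)) (fun _ => z) q -
        p1SiteBare a h (fun y k l => (193 / 125) * ((3 / 4 : ℝ) / 4) * fpChi ((81 / 20 * a) ^ 2) ((27 / 5 * a) ^ 2) (y - fun k => hcpSite a h p k) ^ 2 *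
          (fpSq (y - fun k => hcpSite a h p k))⁻¹ ^ 4 * (if k = l then 1 else 0)) (fun _ => z) q := by
  -- the box
  obtain ⟨hA, hH⟩ := hcpFamilyMin_enclosure ha hh hfam
  rw [abs_sub_le_iff] at hA hH
  obtain ⟨hA1, hA2⟩ := hA
  obtain ⟨hH1, hH2⟩ := hH
  obtain ⟨hρ1, hρ2⟩ := ratioBox_of_hcpFamilyMin ha hh hfam
  obtain ⟨h3lo, h3hi⟩ := sqrt_three_bounds
  have hha : h ^ 2 ≤ 5 / 6 * a ^ 2 := by nlinarith
  -- the distance and the offset vector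
  set r := ‖hcpSite a h q - hcpSite a h p‖ with hr_def
  have hr0 : 0 < r := lt_of_lt_of_le (by positivity) hfar
  have hd : fpSq (fun k => hcpSite a h q k - hcpSite a h p k) = r ^ 2 := by
    rw [hr_def, norm_sq_eq_three]
    simp [fpSq]
  have hPn : p1NRad a h p (fun _ => z) q = fpDot (fun k => hcpSite a h q k - hcpSite a h p k) z := by
    simp only [p1NRad, fpDot, Fin.sum_univ_three]
  -- the normalized variables and their enclosures
  have ha_lo : 0.97119 ≤ a := by linarith
  have ha_hi : a ≤ 0.97139 := by linarith
  have hh_lo : 0.79284 ≤ h := by linarith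
  have hh_hi : h ≤ 0.79304 := by linarith
  have ha2hi : a ^ 2 ≤ 0.97139 ^ 2 := pow_le_pow_left₀ ha.le ha_hi 2
  have ha2lo : 0.97119 ^ 2 ≤ a ^ 2 := pow_le_pow_left₀ (by norm_num) ha_lo 2
  have hs0 : (0 : ℝ) ≤ √3 := Real.sqrt_nonneg 3
  have hW0 : 0 ≤ a ^ 2 * h := by positivity
  have hW : a ^ 2 * h ≤ 0.74832 :=
    calc a ^ 2 * h ≤ 0.97139 ^ 2 * 0.79304 := mul_le_mul ha2hi hh_hi hh.le (by norm_num)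
      _ ≤ 0.74832 := by norm_num
  have hWlo : 0.74781 ≤ a ^ 2 * h :=
    calc (0.74781 : ℝ) ≤ 0.97119 ^ 2 * 0.79284 := by norm_num
      _ ≤ a ^ 2 * h := mul_le_mul ha2lo hh_lo (by norm_num) (by positivity)
  have hV1 : 0.647 ≤ √3 * a ^ 2 * h / 2 := by
    have := mul_le_mul h3lo hWlo (by norm_num) hs0
    nlinarith
  have hV2 : √3 * a ^ 2 * h / 2 ≤ 0.64808 := by
    have := mul_le_mul h3hi hW hW0 (by norm_num)
    nlinarith
  have hv0 : 0 ≤ a / r := by positivity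
  have hv : a / r ≤ 1 / 20 := by rw [div_le_iff₀ hr0]; linarith
  have hη0 : 0 ≤ h ^ 2 / a ^ 2 := by positivity
  have hη : h ^ 2 / a ^ 2 ≤ 0.66679 := by
    rw [div_le_iff₀ (by positivity)]
    calc h ^ 2 ≤ (81657 / 100000 * a) ^ 2 := pow_le_pow_left₀ hh.le hρ2 2
      _ = (81657 / 100000) ^ 2 * a ^ 2 := by ring
      _ ≤ 0.66679 * a ^ 2 := mul_le_mul_of_nonneg_right (by norm_num) (sq_nonneg a)
  have hr60 : 0 ≤ ((r ^ 2)⁻¹) ^ 3 := by positivity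
  have hr6 : ((r ^ 2)⁻¹) ^ 3 ≤ 1 / 64 := by
    have hr2 : 2 ≤ r := by linarith
    have h4 : (4 : ℝ) ≤ r ^ 2 := by nlinarith
    have : (r ^ 2)⁻¹ ≤ 4⁻¹ := inv_anti₀ (by norm_num) h4
    calc ((r ^ 2)⁻¹) ^ 3 ≤ (4⁻¹) ^ 3 := by gcongr
      _ = 1 / 64 := by norm_num
  -- the two star bounds
  set ζ := Real.sqrt (fpSq z) with hζ_def
  have hζ : 0 ≤ ζ := Real.sqrt_nonneg _
  have hz : fpSq z = ζ ^ 2 := (Real.sq_sqrt (fpSq_nonneg z)).symm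
  have hL := radStar_ge ha hh hha p q hfar hd z hζ hz
  have hR := credStar_le ha hh hha p q hfar hd z
  rw [hPn]
  set P := fpDot (fun k => hcpSite a h q k - hcpSite a h p k) z with hP_def
  set u := |P| / r with hu_def
  have hu : 0 ≤ u := by positivity
  have hPu : |P| = u * r := by rw [hu_def]; field_simp
  have hP2 : P ^ 2 = u ^ 2 * r ^ 2 := by rw [← sq_abs, hPu]; ring
  rw [hP2] at hL ⊢
  rw [hPu, hz] at hL
  rw [hz] at hR ⊢
  -- the numerical form and the assembly identity
  have key := tail_numeric (u := u) (ζ := ζ) hV1 hV2 hW0 hW hv0 hv hη0 hη hs0 h3hi hr60 hr6 hu hζ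
  have key' := mul_nonneg (show (0 : ℝ) ≤ ((r ^ 2)⁻¹) ^ 4 by positivity) key
  rw [tail_identity √3 a h r u ζ ha.ne' hr0.ne'] at key'
  rw [show ljSqDeriv (r ^ 2) = 1 / 2 * (((r ^ 2)⁻¹) ^ 4 - ((r ^ 2)⁻¹) ^ 7) from rfl]
  linarith only [key', hL, hR]

/-! ## Outside an explicit index box every site is at least `20a` away -/

/-- **The `20a` index box**: every site `q` outside `Icc(p.1 ± 26) × Icc(p.2.1 ± 34) × Icc(p.2.2 ± 23)` satisfies `‖y_q − y_p‖ ≥ 20a`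
(`3a/4 ≤ h`; one far coordinate, as in part 75's `far_of_not_mem_p1SiteBox`).  So the sites with `‖y_q − y_p‖ < 20a` lie in a FINITE box. -/
theorem twenty_le_of_not_mem_tailBox {a h : ℝ} (ha : 0 < a) (hlo : 3 / 4 * a ≤ h) (p q : ℤ × ℤ × ℤ)
    (hq : q ∉ Finset.Icc (p.1 - 26) (p.1 + 26) ×ˢ (Finset.Icc (p.2.1 - 34) (p.2.1 + 34) ×ˢ Finset.Icc (p.2.2 - 23) (p.2.2 + 23))) :
    20 * a ≤ ‖hcpSite a h q - hcpSite a h p‖ := by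
  have hh : 0 < h := lt_of_lt_of_le (by positivity) hlo
  have hout : 26 < |q.1 - p.1| ∨ 34 < |q.2.1 - p.2.1| ∨ 23 < |q.2.2 - p.2.2| := by
    by_contra hc
    simp only [not_or, not_lt] at hc
    obtain ⟨h1, h2, h3⟩ := hc
    apply hq
    simp only [Finset.mem_product, Finset.mem_Icc]
    rw [abs_le] at h1 h2 h3
    refine ⟨⟨by linarith [h1.1], by linarith [h1.2]⟩, ⟨by linarith [h2.1], by linarith [h2.2]⟩, ⟨by linarith [h3.1], by linarith [h3.2]⟩⟩
  have hlab : ∀ z : ℤ, (haggLabel alternatingHagg z : ℝ) = 0 ∨ (haggLabel alternatingHagg z : ℝ) = 1 := by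
    intro z
    rcases Int.even_or_odd z with hz | hz
    · left; rw [haggLabel_alternating_of_even hz]; simp
    · right; rw [haggLabel_alternating_of_odd hz]; simp
  have h173 : (173 / 100 : ℝ) ≤ √3 := by
    rw [show (173 / 100 : ℝ) = √((173 / 100) ^ 2) by rw [Real.sqrt_sq (by norm_num)]]
    exact Real.sqrt_le_sqrt (by norm_num)
  have hcoord : ∀ j : Fin 3, |hcpSite a h q j - hcpSite a h p j| ≤ ‖hcpSite a h q - hcpSite a h p‖ := by
    intro j
    have := PiLp.norm_apply_le (hcpSite a h q - hcpSite a h p) j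
    rwa [PiLp.sub_apply, Real.norm_eq_abs] at this
  rcases hout with hk | hrest
  · -- third coordinate
    refine le_trans ?_ (hcoord 2)
    rw [hcpSite_apply_two, hcpSite_apply_two]
    have hk' : (27 : ℝ) ≤ |((q.1 : ℝ) - p.1)| := by
      have : (27 : ℤ) ≤ |q.1 - p.1| := hk
      exact_mod_cast this
    rw [show (q.1 : ℝ) * h - (p.1 : ℝ) * h = ((q.1 : ℝ) - p.1) * h by ring, abs_mul, abs_of_pos hh]
    nlinarith
  · by_cases hJ' : 23 < |q.2.2 - p.2.2|
    · -- second coordinate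
      refine le_trans ?_ (hcoord 1)
      rw [hcpSite_apply_one, hcpSite_apply_one]
      have hJr : (24 : ℝ) ≤ |((q.2.2 : ℝ) - p.2.2)| := by
        have : (24 : ℤ) ≤ |q.2.2 - p.2.2| := hJ'
        exact_mod_cast this
      have e : a * √3 / 2 * ((q.2.2 : ℝ) + haggLabel alternatingHagg q.1 / 3) - a * √3 / 2 * ((p.2.2 : ℝ) + haggLabel alternatingHagg p.1 / 3) =
          a * √3 / 2 * (((q.2.2 : ℝ) - p.2.2) + ((haggLabel alternatingHagg q.1 : ℝ) - haggLabel alternatingHagg p.1) / 3) := by ring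
      rw [e, abs_mul, abs_of_pos (by positivity : (0 : ℝ) < a * √3 / 2)]
      have hin : (70 / 3 : ℝ) ≤ |((q.2.2 : ℝ) - p.2.2) + ((haggLabel alternatingHagg q.1 : ℝ) - haggLabel alternatingHagg p.1) / 3| := by
        rcases hlab q.1 with l1 | l1 <;> rcases hlab p.1 with l2 | l2 <;>
          rw [l1, l2, le_abs] <;> rcases le_or_gt 0 ((q.2.2 : ℝ) - p.2.2) with hs | hs <;>
          first
          | (left; rw [abs_of_nonneg hs] at hJr; linarith)
          | (right; rw [abs_of_neg hs] at hJr; linarith)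
      have hm := mul_le_mul_of_nonneg_right hin (by positivity : (0 : ℝ) ≤ a * √3 / 2)
      nlinarith [hm, h173, ha]
    · -- first coordinate
      have hJle : |q.2.2 - p.2.2| ≤ 23 := not_lt.1 hJ'
      have hI : 34 < |q.2.1 - p.2.1| := by
        rcases hrest with hI | hJ
        · exact hI
        · exact absurd hJ hJ'
      refine le_trans ?_ (hcoord 0)
      rw [hcpSite_apply_zero, hcpSite_apply_zero]
      have hIr : (35 : ℝ) ≤ |((q.2.1 : ℝ) - p.2.1)| := by
        have : (35 : ℤ) ≤ |q.2.1 - p.2.1| := hI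
        exact_mod_cast this
      have hJr : |((q.2.2 : ℝ) - p.2.2)| ≤ 23 := by exact_mod_cast hJle
      have e : a * ((q.2.1 : ℝ) + (q.2.2 : ℝ) / 2 + haggLabel alternatingHagg q.1 / 2) -
          a * ((p.2.1 : ℝ) + (p.2.2 : ℝ) / 2 + haggLabel alternatingHagg p.1 / 2) =
          a * (((q.2.1 : ℝ) - p.2.1) + ((q.2.2 : ℝ) - p.2.2) / 2 +
            ((haggLabel alternatingHagg q.1 : ℝ) - haggLabel alternatingHagg p.1) / 2) := by ring
      rw [e, abs_mul, abs_of_pos ha]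
      have hin : (20 : ℝ) ≤ |((q.2.1 : ℝ) - p.2.1) + ((q.2.2 : ℝ) - p.2.2) / 2 +
          ((haggLabel alternatingHagg q.1 : ℝ) - haggLabel alternatingHagg p.1) / 2| := by
        rw [abs_le] at hJr
        obtain ⟨hJ1, hJ2⟩ := hJr
        rcases hlab q.1 with l1 | l1 <;> rcases hlab p.1 with l2 | l2 <;>
          rw [l1, l2, le_abs] <;> rcases le_or_gt 0 ((q.2.1 : ℝ) - p.2.1) with hs | hs <;>
          first
          | (left; rw [abs_of_nonneg hs] at hIr; linarith)
          | (right; rw [abs_of_neg hs] at hIr; linarith)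
      have hm := mul_le_mul_of_nonneg_right hin ha.le
      linarith

/-! ## The endpoint with finite (S) -/

/-- **H12⋆ ON THE BOX FROM FIVE CLOSED CERTIFICATE STATEMENTS, (S) NOW FINITE.**  Part 79's `coreJointCoercive_cell_of_certificates₈` with
hypothesis (S) asked only for the sites `q` of the explicit finite index box `Icc(p.1 ± 26) × Icc(p.2.1 ± 34) × Icc(p.2.2 ± 23)` with
`‖y_q − y_p‖ < 20a` (46 278 sites per representative beyond the 1 158 reach keys) — every other site is `farSite_domination`
(`twenty_le_of_not_mem_tailBox`).  The other four hypotheses are verbatim.  NOT a proof of H12⋆ ((B∃), finite (S), (TAB), (PAY), (NC∃) are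
hypotheses verified outside the kernel), NOT summit progress. -/
theorem coreJointCoercive_cell_of_certificates₉ {a h : ℝ} (ha : 0 < a) (hh : 0 < h) (hfam : HcpFamilyMin a h)
    -- (B∃) THE PER-CELL BUDGET at each representative, exact-defect form, FOR SOME allocation tables (witness data folded in)
    (hB : ∀ p ∈ ({(0, 0, 0), (1, 0, 0)} : Finset (ℤ × ℤ × ℤ)),
      ∃ θ θv : (ℤ × ℤ × ℤ) × (ℤ × ℤ × ℤ) → (ℤ × ℤ × ℤ) × Fin 6 → ℝ,
        (∀ e T, 0 ≤ θ e T) ∧ (∀ e, (Function.support (θ e)).Finite) ∧ (∀ T, (Function.support fun e => θ e T).Finite) ∧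
        (∀ e, p1FarW a h (p1Phi0 p) p e ≠ 0 → ∑ᶠ T, θ e T = 1) ∧
        (∀ e T, θ e T ≠ 0 → ∃ m m' : Fin 4, e.1 = T.1 + p1VertOff (p1Par T.1) T.2 m ∧
          e.1 + e.2 = T.1 + p1VertOff (p1Par T.1) T.2 m') ∧
        (∀ e T, 0 ≤ θv e T) ∧ (∀ e, (Function.support (θv e)).Finite) ∧ (∀ T, (Function.support fun e => θv e T).Finite) ∧
        (∀ e, (∑ i : Fin 3, (2 / 3) * ((if e.2 = p1RouteOff e.1 i then p1FarWv a h (p1Phi0 p) p e.1 else 0) +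
          (if p1RouteOff (e.1 - (p1SV - e.2)) i = p1SV - e.2 then p1FarWv a h (p1Phi0 p) p (e.1 - (p1SV - e.2)) else 0))) ≠ 0 → ∑ᶠ T, θv e T = 1) ∧
        (∀ e T, θv e T ≠ 0 → ∃ m m' : Fin 4, e.1 = T.1 + p1VertOff (p1Par T.1) T.2 m ∧
          e.1 + e.2 = T.1 + p1VertOff (p1Par T.1) T.2 m') ∧
        ∀ (T : (ℤ × ℤ × ℤ) × Fin 6) (G : Fin 3 → Fin 3 → ℝ),
      (∑ᶠ e : (ℤ × ℤ × ℤ) × (ℤ × ℤ × ℤ), θ e T * p1FarW a h (p1Phi0 p) p e *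
          fpSq (fun k => (hcpSite a h (e.1 + e.2) 0 - hcpSite a h e.1 0) * G 0 k +
            (hcpSite a h (e.1 + e.2) 1 - hcpSite a h e.1 1) * G 1 k + (hcpSite a h (e.1 + e.2) 2 - hcpSite a h e.1 2) * G 2 k)) +
      (∑ᶠ e : (ℤ × ℤ × ℤ) × (ℤ × ℤ × ℤ), θv e T *
          (∑ i : Fin 3, (2 / 3) * ((if e.2 = p1RouteOff e.1 i then p1FarWv a h (p1Phi0 p) p e.1 else 0) +
            (if p1RouteOff (e.1 - (p1SV - e.2)) i = p1SV - e.2 then p1FarWv a h (p1Phi0 p) p (e.1 - (p1SV - e.2)) else 0))) *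
          fpSq (fun k => (hcpSite a h (e.1 + e.2) 0 - hcpSite a h e.1 0) * G 0 k +
            (hcpSite a h (e.1 + e.2) 1 - hcpSite a h e.1 1) * G 1 k + (hcpSite a h (e.1 + e.2) 2 - hcpSite a h e.1 2) * G 2 k)) +
      p1CellDefectG a h (fun y k l => (193 / 125) * ((7 * (5 / 4 : ℝ) + 3 / 4) / 4) * fpChi ((81 / 20 * a) ^ 2) ((27 / 5 * a) ^ 2) (y - fun k => hcpSite a h p k) ^ 2 *
          (fpSq (y - fun k => hcpSite a h p k))⁻¹ ^ 5 * ((y - fun k => hcpSite a h p k) k * (y - fun k => hcpSite a h p k) l)) T G ≤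
      (193 / 125) * ((5 / 2 * (1 / 24 * fpSymSq G) + 5 / 2 * (1 / 24 * (fpFrob G - fpSymSq G))) *
        ∫ y in p1RealCell a h T, fpChi ((81 / 20 * a) ^ 2) ((27 / 5 * a) ^ 2) (y - fun k => hcpSite a h p k) ^ 2 * (fpSq (y - fun k => hcpSite a h p k))⁻¹ ^ 3))
    -- (S) per-site domination off the PINNED reach set at the FINITELY MANY sites of the 20a index box with `‖y_q − y_p‖ < 20a`; (TAB) the PINNED certified tables
    (hS : ∀ p ∈ ({(0, 0, 0), (1, 0, 0)} : Finset (ℤ × ℤ × ℤ)),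
      ∀ q ∈ Finset.Icc (p.1 - 26) (p.1 + 26) ×ˢ (Finset.Icc (p.2.1 - 34) (p.2.1 + 34) ×ˢ Finset.Icc (p.2.2 - 23) (p.2.2 + 23)),
      q ∉ p1QB p → q ≠ p → ‖hcpSite a h q - hcpSite a h p‖ < 20 * a → ∀ z : Fin 3 → ℝ,
      0 ≤ 1 / 2 * (ljSqDeriv (‖hcpSite a h q - hcpSite a h p‖ ^ 2) * fpSq z +
          2 * (1 / 2 * (7 * ((‖hcpSite a h q - hcpSite a h p‖ ^ 2)⁻¹) ^ 8 -
            4 * ((‖hcpSite a h q - hcpSite a h p‖ ^ 2)⁻¹) ^ 5)) * p1NRad a h p (fun _ => z) q ^ 2) +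
        p1SiteBare a h (fun y k l => (193 / 125) * ((7 * (5 / 4 : ℝ) + 3 / 4) / 4) * fpChi ((81 / 20 * a) ^ 2) ((27 / 5 * a) ^ 2) (y - fun k => hcpSite a h p k) ^ 2 *
          (fpSq (y - fun k => hcpSite a h p k))⁻¹ ^ 5 * ((y - fun k => hcpSite a h p k) k * (y - fun k => hcpSite a h p k) l)) (fun _ => z) q -
        p1SiteBare a h (fun y k l => (193 / 125) * ((3 / 4 : ℝ) / 4) * fpChi ((81 / 20 * a) ^ 2) ((27 / 5 * a) ^ 2) (y - fun k => hcpSite a h p k) ^ 2 *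
          (fpSq (y - fun k => hcpSite a h p k))⁻¹ ^ 4 * (if k = l then 1 else 0)) (fun _ => z) q)
    (hTab : ∀ p ∈ ({(0, 0, 0), (1, 0, 0)} : Finset (ℤ × ℤ × ℤ)), ∀ q ∈ p1QB p, q ≠ p → ∀ z : Fin 3 → ℝ,
      (p1LU p q).1 * p1NRad a h p (fun _ => z) q ^ 2 ≤
        p1SiteBare a h (fun y k l => (193 / 125) * ((7 * (5 / 4 : ℝ) + 3 / 4) / 4) * fpChi ((81 / 20 * a) ^ 2) ((27 / 5 * a) ^ 2) (y - fun k => hcpSite a h p k) ^ 2 *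
          (fpSq (y - fun k => hcpSite a h p k))⁻¹ ^ 5 * ((y - fun k => hcpSite a h p k) k * (y - fun k => hcpSite a h p k) l)) (fun _ => z) q ∧
      p1SiteBare a h (fun y k l => (193 / 125) * ((3 / 4 : ℝ) / 4) * fpChi ((81 / 20 * a) ^ 2) ((27 / 5 * a) ^ 2) (y - fun k => hcpSite a h p k) ^ 2 *
          (fpSq (y - fun k => hcpSite a h p k))⁻¹ ^ 4 * (if k = l then 1 else 0)) (fun _ => z) q ≤ (p1LU p q).2 * fpSq z)
    -- (PAY) the far table's column-sum enclosures by the PINNED payments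
    (hPAY : ∀ p ∈ ({(0, 0, 0), (1, 0, 0)} : Finset (ℤ × ℤ × ℤ)), ∀ s ∈ p1BondOffsets, (193 / 125) * (2 / 5) / a ^ 4 *
      (∑' q : ℤ × ℤ × ℤ, p1RecTable a h (p1SplitDensity (81 / 20 * a) (27 / 5 * a)) (decide (Even p.1)) (q - p) s) ≤ p1Paym p s)
    -- (NC∃) THE NEAR CERTIFICATE WITH THE EXACT COLLAR FLUX at both representatives, FOR SOME stencilled decaying finitely supported near tables
    (hNC : ∃ M₁ N : Bool → (ℤ × ℤ × ℤ) → (ℤ × ℤ × ℤ) → (ℤ × ℤ × ℤ) → ℝ, ∃ QT : (ℤ × ℤ × ℤ) → Finset (ℤ × ℤ × ℤ),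
      (∀ b d s s', s ∉ p1BondOffsets ∨ s' ∉ p1BondOffsets → M₁ b d s s' = 0 ∧ N b d s s' = 0) ∧
      (∃ C₁ : ℝ, ∀ p q : ℤ × ℤ × ℤ, ∀ s s', |M₁ (decide (Even p.1)) (q - p) s s'| ≤
        C₁ * ((1 + ‖hcpSite a h q - hcpSite a h p‖)⁻¹) ^ 6 ∧
      |N (decide (Even p.1)) (q - p) s s'| ≤ C₁ * ((1 + ‖hcpSite a h q - hcpSite a h p‖)⁻¹) ^ 6) ∧
      (∀ p ∈ ({(0, 0, 0), (1, 0, 0)} : Finset (ℤ × ℤ × ℤ)), ∀ q : ℤ × ℤ × ℤ, q ∉ QT p → ∀ s s',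
      M₁ (decide (Even p.1)) (q - p) s s' = 0 ∧ M₁ (decide (Even q.1)) (p - q) s s' = 0 ∧
      N (decide (Even p.1)) (q - p) s s' = 0 ∧ N (decide (Even q.1)) (p - q) s' s = 0) ∧
      ∀ p ∈ ({(0, 0, 0), (1, 0, 0)} : Finset (ℤ × ℤ × ℤ)), ∀ V : ℤ × ℤ × ℤ → (Fin 3 → ℝ), V p = 0 →
      (∀ Z : Fin 3 → Fin 3 → ℝ, (∀ j k, Z j k = -Z k j) →
        ∑ q ∈ (if Even p.1 then hcpStarIdx.image (fun d => d + p) else hcpStarIdx.image (fun d => p - d)), ∑ k : Fin 3, V q k * (∑ j : Fin 3, (hcpSite a h q j - hcpSite a h p j) * Z j k) = 0) →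
      0 ≤ p1NearForm a h (1 / 3) (1 / 12) (193 / 125) p p1Stencil (p1Beta a h) M₁ N (p1FarW a h (p1Phi0 p) p) p1SV (p1FarWv a h (p1Phi0 p) p) (fun s => -p1Beta a h (decide (Even p.1)) 0 s) (if Even p.1 then hcpStarIdx.image (fun d => d + p) else hcpStarIdx.image (fun d => p - d)) (p1QB p) (QT p) ∅ (p1FarLegs (p1Phi0 p) p) (fun q => (p1LU p q).1) (fun q => (p1LU p q).2) (p1Paym p) (fun _ => 0) (fun _ _ => 0) V -
        193 / 125 * p1ExactFluxSum a h p V) :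
    CoreJointCoercive a h (1 / 3) (1 / 12)     := by
  have hlo : 3 / 4 * a ≤ h := by linarith [(ratioBox_of_hcpFamilyMin ha hh hfam).1]
  refine coreJointCoercive_cell_of_certificates₈ ha hh hfam hB (fun p hp q hq hqp z => ?_) hTab hPAY hNC
  by_cases hbox : q ∈ Finset.Icc (p.1 - 26) (p.1 + 26) ×ˢ (Finset.Icc (p.2.1 - 34) (p.2.1 + 34) ×ˢ Finset.Icc (p.2.2 - 23) (p.2.2 + 23))
  · by_cases hlt : ‖hcpSite a h q - hcpSite a h p‖ < 20 * a
    · exact hS p hp q hbox hq hqp hlt z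
    · exact farSite_domination ha hh hfam p q (not_lt.1 hlt) z
  · exact farSite_domination ha hh hfam p q (twenty_le_of_not_mem_tailBox ha hlo p q hbox) z

end Summit.AtomisticToContinuum.Crystallization.Theorems.StrictSplittingRuleBirth

end
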